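import Summits.ResolutionOfSingularities.ResolutionOfSingularities.Theorems.UniversalCellsCampaignW82RootTowerPerfect
import Summits.ResolutionOfSingularities.ResolutionOfSingularities.Theorems.DescentDescentPerfectToAllSeparableBaseChange
import Literature.AlgebraicGeometry.Resolution.AlterationsDescentStage
import Literature.AlgebraicGeometry.Resolution.SmoothOfRegularPerfectField
import Literature.AlgebraicGeometry.Resolution.ProjectiveSpaceRegular
import Literature.AlgebraicGeometry.Resolution.AlterationsLemma32
import Literature.AlgebraicGeometry.Resolution.QuasiExcellentSchemes
import Mathlib.AlgebraicGeometry.Morphisms.LocalFlatDescent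
import Mathlib.FieldTheory.PurelyInseparable.Exponent
import Mathlib.FieldTheory.IsAlgClosed.AlgebraicClosure
import HarnessLib

/-!
# [OURS · L1 W8.2] THE REGULAR-TWIST CRITERION over `K = M(t)`, `M` perfect: a `K`-scheme of finite type is SMOOTH
# over `K` iff its base change to `K(t^{1/p})` — equivalently its FROBENIUS TWIST — is REGULAR

Cell `res-hironaka` (run/shared/lean/pub/res-hironaka/), LADDER-RESOLUTION rung L (RESCUE), slot W8.2; host route
`UniversalCells`, host item `PrimeFieldToPerfect` (stmt-ResolutionOfSingularities-15233), door 1. Proofs file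
(Theses-free), written by res-L1-s82-pv-1 (gen 5). This is form (E3) of Cruxes/PrimeFieldToPerfect/KERNEL.md §2
(«regular-twist criterion: a regular `Y` of finite type over `K` (`[K : K^p] = p`) is smooth over `K` iff
`Y ⊗_K K^{1/p}` (≅ the twist `Y^{(p)}`) is regular — `k^{1/p}`-regularity suffices»), kernel-checked for the residual
field `K = M(t)` of the slot's normal forms (`PerfectionStepAt M n`, `FrobeniusTwistStepAt p M n`).

* `isRegular_pullback_of_isRegular_pullback` — charts: regularity of `Y ×_K E₁` transfers to `Y ×_K E₂` along any
  implication «`B ⊗_K E₁` regular ⇒ `B ⊗_K E₂` regular» valid for the finite type `K`-algebras `B` (fields `E₁, E₂`).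
* `isRegular_pullback_level` — with a `p`-th root tower `θ` of `t` in `L ⊇ K` (`…RootTowerAlgebra`): if `Y ×_K K⟮θ 1⟯`
  is regular then so is `Y ×_K K⟮θ (n+1)⟯` for every `n` (Stacks 07PG up the tower,
  `isRegularRing_tensor_level_of_one`).
* **`smooth_of_isRegular_pullback_levelOne`** — `M` PERFECT: if `Y ×_K K⟮t^{1/p}⟯` is regular then `Y ⟶ Spec K` is
  SMOOTH. PROOF: all levels `Y ×_K K⟮t^{1/pⁿ}⟯` are regular; every finitely generated subextension of the perfect
  union `K_∞ = K(t^{1/p^∞})` lies in a level (`exists_level_of_finset_subset`), so `Y ×_K K_∞` is regular by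
  REGULARITY OF THE LIMIT (route `Descent`'s `isRegular_pullback_of_fgLevels`) and flat descent to the levels; regular
  over the PERFECT `K_∞` is smooth (`smooth_of_isRegular_of_perfectField`), and smoothness descends along the fpqc
  cover `Spec K_∞ → Spec K` (Mathlib `LocalFlatDescent`).
* **`smooth_iff_isRegular_frobeniusTwist`** — `M` PERFECT, `q : Y ⟶ Spec K` of finite type:
  `Smooth q ↔ Scheme.IsRegular (Y^{(p)})`, the Frobenius twist `Y^{(p)} = Y ×_{K, Frob} Spec K`
  (`pullback q (Spec.map Frob_K)`), which is the base change of `Y ×_K K⟮t^{1/p}⟯` along the iterated-Frobenius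
  isomorphism onto `K` (Mathlib `IsPurelyInseparable.iterateFrobenius`; exponent of `K⟮t^{1/p}⟯ / K` is `≤ 1`).

So the residual of slot W8.2 («some Frobenius twist of `X₀` has a SMOOTH proper birational model») reads, purely in
terms of the REGULAR models the hypothesis `Res(M(t))` supplies: **some twist `X₀^{(p^e)}` has a resolution `Y` whose
NEXT twist `Y^{(p)}` — a proper birational model of `X₀^{(p^{e+1})}` — is again regular** (links leaf
`…RegularTwistLinks.lean`).

HONEST FRAMING. OURS theorems (role replaced: §17 ¶2 p.89 l.59–62 of [Hironaka2017], typed AS PRINTED as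
`S17Methodology.U89_3`); NOT statements of the manuscript; classical commutative algebra / EGA 0_IV §22 folklore for
`p`-rank one, assembled from the tree (Stacks 07PG, regularity of limits, smooth ⇔ regular over perfect fields, fpqc
descent). Nothing here is progress on the open residual; it is a normal form. AI work, weaker than expert review; no
claim beyond the kernel.
-/

noncomputable section

set_option linter.dupNamespace false -- mandated namespace of this single-conjunct summit

open CategoryTheory CategoryTheory.Limits AlgebraicGeometry TopologicalSpace TensorProduct IntermediateField
open Literature.AlgebraicGeometry.Resolution
open Literature.AlgebraicGeometry.Resolution.DeJong1996.Stage (isRegular_of_flat_surjective surjective_specMap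
  flat_specMap fpqc_specMap)

namespace Summit.ResolutionOfSingularities.ResolutionOfSingularities.Theorems.CampaignW82

/-! ## §1 Charts: transferring regularity between two base changes -/

/-- **Chart transfer.** Let `q : Y → Spec L` be locally of finite type and `E₁`, `E₂` field extensions of `L`. If
for every `L`-algebra `B` of finite type regularity of `B ⊗_L E₁` implies regularity of `B ⊗_L E₂`, then regularity
of `Y ×_L E₁` implies regularity of `Y ×_L E₂`: both are covered by the charts `Spec (Γ(Y, W) ⊗_L Eᵢ)` over the
affine opens `W` of `Y` (route `Descent`'s `specTensorChart`). [folklore] -/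
theorem isRegular_pullback_of_isRegular_pullback {L : Type} [Field L] (E₁ E₂ : Type) [Field E₁] [Field E₂]
    [Algebra L E₁] [Algebra L E₂]
    (hE : ∀ (B : Type) [CommRing B] [Algebra L B], Algebra.FiniteType L B →
      IsRegularRing (B ⊗[L] E₁) → IsRegularRing (B ⊗[L] E₂))
    {Y : Scheme.{0}} (q : Y ⟶ Spec (.of L)) [LocallyOfFiniteType q]
    (h₁ : Scheme.IsRegular (pullback q (specOfAlgebra L E₁))) :
    Scheme.IsRegular (pullback q (specOfAlgebra L E₂)) := by
  intro y
  -- an affine chart `Spec B ↪ Y` at the image of `y`, `B` of finite type over `L`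
  obtain ⟨W, hW, hyW, -⟩ := exists_isAffineOpen_mem_and_subset (X := Y)
    (x := pullback.fst q (specOfAlgebra L E₂) y) (U := ⊤) trivial
  let iW : Spec Γ(Y, W) ⟶ Y := hW.fromSpec
  let φ₀ : CommRingCat.of L ⟶ Γ(Y, W) := Spec.preimage (iW ≫ q)
  letI : Algebra L Γ(Y, W) := φ₀.hom.toAlgebra
  have hi : iW ≫ q = Spec.map (CommRingCat.ofHom (algebraMap L Γ(Y, W))) := by
    rw [RingHom.algebraMap_toAlgebra, CommRingCat.ofHom_hom, Spec.map_preimage]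
  haveI : Algebra.FiniteType L Γ(Y, W) := by
    have h1 : LocallyOfFiniteType (Spec.map (CommRingCat.ofHom (algebraMap L Γ(Y, W)))) := by
      rw [← hi]; infer_instance
    have h2 := (HasRingHomProperty.Spec_iff (P := @LocallyOfFiniteType)).mp h1
    exact RingHom.finiteType_algebraMap.mp h2
  -- `B ⊗ E₁` is regular: its local rings are local rings of `Y ×_L E₁` (through the chart over `W`)
  haveI : IsNoetherianRing (Γ(Y, W) ⊗[L] E₁) := isNoetherianRing_tensor_of_finiteType E₁ Γ(Y, W)
  let c₁ := specTensorChart E₁ q iW hi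
  have hB₁ : IsRegularRing (Γ(Y, W) ⊗[L] E₁) := isRegularRing_iff.mpr fun 𝔭 _ =>
    (isRegularLocalRing_stalk_Spec_iff (Γ(Y, W) ⊗[L] E₁) ⟨𝔭, ‹_›⟩).mp
      ((isRegularLocalRing_stalk_iff_of_isOpenImmersion c₁ ⟨𝔭, ‹_›⟩).mp (h₁ _))
  haveI : IsRegularRing (Γ(Y, W) ⊗[L] E₂) := hE Γ(Y, W) inferInstance hB₁
  -- `y` lies in the chart `Spec (B ⊗_L E₂)`
  let c := specTensorChart E₂ q iW hi
  have hyrange : y ∈ Set.range c := by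
    change y ∈ Set.range (specTensorChart E₂ q iW hi)
    rw [range_specTensorChart, Set.mem_preimage, IsAffineOpen.range_fromSpec]
    exact hyW
  obtain ⟨ζ, hζ⟩ := hyrange
  rw [← hζ]
  exact (isRegularLocalRing_stalk_iff_of_isOpenImmersion c ζ).mpr
    ((isRegularLocalRing_stalk_Spec_iff _ ζ).mpr inferInstance)

/-- Regularity is transported along an isomorphism of field extensions of the base: if `e : E₁ ≃ₐ[L] E₂` then
`Y ×_L E₁` regular ⇒ `Y ×_L E₂` regular. [folklore] -/
theorem isRegular_pullback_of_algEquiv {L : Type} [Field L] (E₁ E₂ : Type) [Field E₁] [Field E₂]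
    [Algebra L E₁] [Algebra L E₂] (e : E₁ ≃ₐ[L] E₂)
    {Y : Scheme.{0}} (q : Y ⟶ Spec (.of L)) [LocallyOfFiniteType q]
    (h₁ : Scheme.IsRegular (pullback q (specOfAlgebra L E₁))) :
    Scheme.IsRegular (pullback q (specOfAlgebra L E₂)) :=
  isRegular_pullback_of_isRegular_pullback E₁ E₂ (fun B _ _ _ hB => by
    haveI := hB
    exact IsRegularRing.of_ringEquiv (R := B ⊗[L] E₁)
      (Algebra.TensorProduct.congr (AlgEquiv.refl (R := L) (A₁ := B)) e).toRingEquiv) q h₁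

/-! ## §2 Regularity climbs the root tower from level one -/

section Tower

variable {p : ℕ} [Fact p.Prime] {M : Type} [Field M] [CharP M p] {L : Type} [Field L]
  [Algebra (RatFunc M) L] (θ : ℕ → L) (hθ0 : θ 0 = algebraMap (RatFunc M) L RatFunc.X)
  (hθ : ∀ n, θ (n + 1) ^ p = θ n)

include hθ0 hθ

/-- **All levels are regular if the first is.** For `q : Y → Spec M(t)` locally of finite type and a root tower `θ`
of `t` in `L`: if `Y ×_K K⟮θ 1⟯` is regular then `Y ×_K K⟮θ (n+1)⟯` is regular for every `n` (Stacks 07PG up the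
tower, `isRegularRing_tensor_level_of_one`, on the affine charts). [cite: StacksProject, Tag 07PG] -/
theorem isRegular_pullback_level {Y : Scheme.{0}} (q : Y ⟶ Spec (.of (RatFunc M))) [LocallyOfFiniteType q]
    (h1 : Scheme.IsRegular (pullback q (specOfAlgebra (RatFunc M) (RatFunc M)⟮θ 1⟯))) (n : ℕ) :
    Scheme.IsRegular (pullback q (specOfAlgebra (RatFunc M) (RatFunc M)⟮θ (n + 1)⟯)) := by
  refine isRegular_pullback_of_isRegular_pullback _ _ (fun B _ _ _ hB => ?_) q h1
  haveI : IsRegularRing ((RatFunc M)⟮θ 1⟯ ⊗[RatFunc M] B) :=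
    IsRegularRing.of_ringEquiv (R := B ⊗[RatFunc M] (RatFunc M)⟮θ 1⟯)
      (Algebra.TensorProduct.comm (RatFunc M) B _).toRingEquiv
  haveI := isRegularRing_tensor_level_of_one θ hθ0 hθ B ‹_› n
  exact IsRegularRing.of_ringEquiv (R := (RatFunc M)⟮θ (n + 1)⟯ ⊗[RatFunc M] B)
    (Algebra.TensorProduct.comm (RatFunc M) _ B).toRingEquiv

end Tower

/-! ## §3 The criterion: regular after adjoining `t^{1/p}` ⇒ smooth -/

/-- Descent of regularity along a field map of the base: for field maps `τ : K → E'` and `ψ : E → E'` with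
`ψ ∘ (K → E) = τ` and `q : Y → Spec K` of finite type, `Y ×_{K,τ} E'` regular ⇒ `Y ×_K E` regular (the projection
`Y ×_{K,τ} E' ≅ (Y ×_K E) ×_{E,ψ} E' → Y ×_K E` is flat and surjective; Matsumura 23.7 (i)). [folklore] -/
theorem isRegular_pullback_of_ringHom {K : Type} [Field K] {E E' : Type} [Field E] [Field E'] [Algebra K E]
    (τ : K →+* E') (ψ : E →+* E') (hψ : ψ.comp (algebraMap K E) = τ)
    {Y : Scheme.{0}} (q : Y ⟶ Spec (.of K)) [LocallyOfFiniteType q] [QuasiCompact q]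
    (h : Scheme.IsRegular (pullback q (Spec.map (CommRingCat.ofHom τ)))) :
    Scheme.IsRegular (pullback q (specOfAlgebra K E)) := by
  let qE : pullback q (specOfAlgebra K E) ⟶ Spec (.of E) := pullback.snd _ _
  have hcomp : Spec.map (CommRingCat.ofHom ψ) ≫ specOfAlgebra K E = Spec.map (CommRingCat.ofHom τ) := by
    change Spec.map (CommRingCat.ofHom ψ) ≫ Spec.map (CommRingCat.ofHom (algebraMap K E)) = _
    rw [← Spec.map_comp, ← CommRingCat.ofHom_comp, hψ]
  let e : pullback qE (Spec.map (CommRingCat.ofHom ψ)) ≅ pullback q (Spec.map (CommRingCat.ofHom τ)) :=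
    pullbackLeftPullbackSndIso q (specOfAlgebra K E) (Spec.map (CommRingCat.ofHom ψ)) ≪≫
      pullback.congrHom rfl hcomp
  -- the iterated pullback is regular (isomorphic to `Y ×_{K,τ} E'`)
  haveI : IsNoetherian (pullback q (Spec.map (CommRingCat.ofHom τ))) :=
    Scheme.isNoetherian_of_finiteType_over_field (pullback.snd q (Spec.map (CommRingCat.ofHom τ)))
  haveI : IsNoetherian (pullback qE (Spec.map (CommRingCat.ofHom ψ))) :=
    Scheme.isNoetherian_of_finiteType_over_field (pullback.snd qE (Spec.map (CommRingCat.ofHom ψ)))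
  have h' : Scheme.IsRegular (pullback qE (Spec.map (CommRingCat.ofHom ψ))) :=
    isRegular_of_flat_surjective e.inv h
  -- descend along the flat surjective projection onto `Y ×_K E`
  haveI : IsNoetherian (pullback q (specOfAlgebra K E)) := Scheme.isNoetherian_of_finiteType_over_field qE
  haveI : Surjective (Spec.map (CommRingCat.ofHom ψ)) := surjective_specMap ψ
  haveI : Flat (Spec.map (CommRingCat.ofHom ψ)) := flat_specMap ψ
  exact isRegular_of_flat_surjective (pullback.fst qE (Spec.map (CommRingCat.ofHom ψ))) h'

section Criterion

variable {p : ℕ} [Fact p.Prime] {M : Type} [Field M] [CharP M p] [PerfectField M] {L : Type} [Field L]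
  [Algebra (RatFunc M) L] (θ : ℕ → L) (hθ0 : θ 0 = algebraMap (RatFunc M) L RatFunc.X)
  (hθ : ∀ n, θ (n + 1) ^ p = θ n)

include hθ0 hθ


/-- **THE CRITERION, TOWER FORM.** Let `M` be a perfect field of characteristic `p`, `K = RatFunc M`, `θ` a `p`-th
root tower of `t` in a field `L ⊇ K`, and `q : Y → Spec K` of finite type. If `Y ×_K K⟮t^{1/p}⟯` is regular, then
`q` is SMOOTH. (All levels are regular; the perfect union `K_∞` of the tower has every finitely generated
subextension inside a level, so `Y ×_K K_∞` is regular by regularity of the limit and flat descent; regular over the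
perfect `K_∞` is smooth; smoothness descends along the fpqc cover `Spec K_∞ → Spec K`.)
[cite: EGAIV2, Prop. 6.7.4; StacksProject, Tag 07PG] -/
theorem smooth_of_isRegular_pullback_levelOne {Y : Scheme.{0}} (q : Y ⟶ Spec (.of (RatFunc M)))
    [LocallyOfFiniteType q] [QuasiCompact q]
    (h1 : Scheme.IsRegular (pullback q (specOfAlgebra (RatFunc M) (RatFunc M)⟮θ 1⟯))) : Smooth q := by
  classical
  set Kinf : IntermediateField (RatFunc M) L := IntermediateField.adjoin (RatFunc M) (Set.range θ) with hKinf
  haveI : PerfectField Kinf := perfectField_adjoin_range_rootTower θ hθ0 hθ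
  -- ### every finitely generated level of `K_∞ / K` lies in some `K⟮θ (n+1)⟯`, hence is regular
  have hfin : ∀ (E : Type) [Field E] [Algebra (RatFunc M) E] [Algebra E Kinf] [IsScalarTower (RatFunc M) E Kinf],
      Algebra.EssFiniteType (RatFunc M) E → Scheme.IsRegular (pullback q (specOfAlgebra (RatFunc M) E)) := by
    intro E _ _ _ _ hE
    -- generators of `E` and a level containing their images
    obtain ⟨s, hs⟩ := IntermediateField.fg_top_iff.mpr hE
    let ι : E →+* L := (algebraMap Kinf L).comp (algebraMap E Kinf)
    have hιK : ∀ c : RatFunc M, ι (algebraMap (RatFunc M) E c) = algebraMap (RatFunc M) L c := fun c => by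
      change algebraMap Kinf L (algebraMap E Kinf (algebraMap (RatFunc M) E c)) = _
      rw [← IsScalarTower.algebraMap_apply (RatFunc M) E Kinf]
      rfl
    have hιmem : ∀ x : E, ι x ∈ Kinf := fun x => (algebraMap E Kinf x).2
    obtain ⟨n, hn⟩ := exists_level_of_finset_subset θ hθ (s.image ι) (by
      intro y hy
      rw [Finset.coe_image] at hy
      obtain ⟨x, -, rfl⟩ := hy
      exact hιmem x)
    -- the whole image of `E` lies in the level `K⟮θ (n+1)⟯`
    have hlev : ∀ x : E, ι x ∈ (RatFunc M)⟮θ (n + 1)⟯ := by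
      have hgen : ∀ x ∈ IntermediateField.adjoin (RatFunc M) (↑s : Set E), ι x ∈ (RatFunc M)⟮θ (n + 1)⟯ := by
        intro x hx
        refine IntermediateField.adjoin_induction (RatFunc M) (p := fun x _ => ι x ∈ (RatFunc M)⟮θ (n + 1)⟯)
          ?_ ?_ ?_ ?_ ?_ hx
        · intro x hx
          exact level_mono θ hθ (Nat.le_succ n) (hn (by rw [Finset.coe_image]; exact ⟨x, hx, rfl⟩))
        · intro c
          rw [hιK]
          exact IntermediateField.algebraMap_mem _ c
        · intro x y _ _ hx hy
          rw [map_add]; exact add_mem hx hy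
        · intro x _ hx
          rw [map_inv₀]; exact inv_mem hx
        · intro x y _ _ hx hy
          rw [map_mul]; exact mul_mem hx hy
      intro x
      exact hgen x (by rw [hs]; trivial)
    -- the field map `ψ : E → K⟮θ (n+1)⟯` over `K`, and descent of regularity from the level
    let ψ : E →+* (RatFunc M)⟮θ (n + 1)⟯ := ι.codRestrict _ hlev
    have hψ : ψ.comp (algebraMap (RatFunc M) E) = algebraMap (RatFunc M) (RatFunc M)⟮θ (n + 1)⟯ := by
      refine RingHom.ext fun c => ?_
      apply Subtype.ext
      exact hιK c
    exact isRegular_pullback_of_ringHom _ ψ hψ q (isRegular_pullback_level θ hθ0 hθ q h1 n)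
  -- ### `Y ×_K K_∞` is regular, hence smooth over the perfect `K_∞`
  have hreg : Scheme.IsRegular (pullback q (specOfAlgebra (RatFunc M) Kinf)) :=
    isRegular_pullback_of_fgLevels q hfin
  have hsm : Smooth (pullback.snd q (specOfAlgebra (RatFunc M) Kinf)) :=
    smooth_of_isRegular_of_perfectField _ hreg
  -- ### smoothness descends along `Spec K_∞ → Spec K`
  exact MorphismProperty.of_isPullback_of_descendsAlong (P := @Smooth)
    (Q := @Surjective ⊓ @Flat ⊓ @QuasiCompact)
    (IsPullback.of_hasPullback q (specOfAlgebra (RatFunc M) Kinf)).flip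
    (fpqc_specMap (algebraMap (RatFunc M) Kinf)) hsm

end Criterion

/-! ## §4 The criterion in Frobenius-twist form -/

section Twist

variable {p : ℕ} [Fact p.Prime] (M : Type) [Field M] [CharP M p]

/-- **The level `K⟮t^{1/p}⟯` has exponent `≤ 1` over `K`**: every element of `K⟮θ⟯` (`θ^p = t`) has its `p`-th
power in `K` (`(Σ cᵢ θ^i)^p = Σ cᵢ^p t^i`). [folklore] -/
theorem exponent_adjoin_root_le_one {L : Type} [Field L] [Algebra (RatFunc M) L] {θ : L}
    (hθ : θ ^ p = algebraMap (RatFunc M) L RatFunc.X) [IsPurelyInseparable.HasExponent (RatFunc M) (RatFunc M)⟮θ⟯] :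
    IsPurelyInseparable.exponent (RatFunc M) (RatFunc M)⟮θ⟯ ≤ 1 := by
  classical
  have hp : p.Prime := Fact.out
  haveI : ExpChar (RatFunc M) p := ExpChar.prime hp
  have hint : IsIntegral (RatFunc M) θ :=
    ⟨Polynomial.X ^ p - Polynomial.C RatFunc.X, Polynomial.monic_X_pow_sub_C _ hp.ne_zero,
      by rw [Polynomial.eval₂_sub, Polynomial.eval₂_X_pow, Polynomial.eval₂_C, hθ, sub_self]⟩
  haveI : CharP L p := charP_of_injective_algebraMap (algebraMap (RatFunc M) L).injective p
  haveI : CharP (RatFunc M)⟮θ⟯ p :=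
    (algebraMap (RatFunc M)⟮θ⟯ L).charP (algebraMap (RatFunc M)⟮θ⟯ L).injective p
  haveI : ExpChar (RatFunc M)⟮θ⟯ p := ExpChar.prime hp
  -- `gen ^ p = t`
  have hgen : (AdjoinSimple.gen (RatFunc M) θ) ^ p = algebraMap (RatFunc M) (RatFunc M)⟮θ⟯ RatFunc.X :=
    Subtype.ext (by rw [IntermediateField.coe_pow, AdjoinSimple.coe_gen, hθ]; rfl)
  have hcomp : (algebraMap (RatFunc M) (RatFunc M)⟮θ⟯).comp (frobenius (RatFunc M) p) =
      (frobenius (RatFunc M)⟮θ⟯ p).comp (algebraMap (RatFunc M) (RatFunc M)⟮θ⟯) := by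
    ext c
    simp only [RingHom.comp_apply, frobenius_def, map_pow]
  -- every element of `K⟮θ⟯` has its `p`-th power in `K`
  have key : ∀ a : (RatFunc M)⟮θ⟯, a ^ p ∈ (algebraMap (RatFunc M) (RatFunc M)⟮θ⟯).range := by
    intro a
    obtain ⟨f, hf⟩ := (adjoin.powerBasis hint).exists_eq_aeval' a
    rw [adjoin.powerBasis_gen] at hf
    refine ⟨Polynomial.aeval RatFunc.X (f.map (frobenius (RatFunc M) p)), ?_⟩
    rw [hf, ← frobenius_def, Polynomial.map_aeval_eq_aeval_map hcomp, frobenius_def, hgen,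
      Polynomial.aeval_algebraMap_apply]
  have h1 : ∀ a : (RatFunc M)⟮θ⟯,
      a ^ ringExpChar (RatFunc M) ^ 1 ∈ (algebraMap (RatFunc M) (RatFunc M)⟮θ⟯).range := by
    intro a
    rw [ringExpChar.eq (RatFunc M) p, pow_one]
    exact key a
  unfold IsPurelyInseparable.exponent
  exact Nat.find_min' _ h1

variable [PerfectField M]

/-- **THE REGULAR-TWIST CRITERION** (Cruxes/PrimeFieldToPerfect/KERNEL.md §2 (E3), kernel-checked for `K = M(t)`,
`M` perfect): for `q : Y ⟶ Spec K` of finite type, `q` is SMOOTH iff the Frobenius twist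
`Y^{(p)} = Y ×_{K, Frob} Spec K` is REGULAR. (`→`: the twist is smooth over `K`. `←`: the twist is the base change of
`Y ×_K K⟮t^{1/p}⟯` along the iterated Frobenius `K⟮t^{1/p}⟯ → K` (exponent `≤ 1`), so regularity descends to the
first level of a root tower of `t` in an algebraic closure, and `smooth_of_isRegular_pullback_levelOne` applies.)
[cite: EGAIV2, Prop. 6.7.4; StacksProject, Tag 07PG] -/
theorem smooth_iff_isRegular_frobeniusTwist {Y : Scheme.{0}} (q : Y ⟶ Spec (.of (RatFunc M)))
    [LocallyOfFiniteType q] [QuasiCompact q] :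
    Smooth q ↔ Scheme.IsRegular (pullback q (Spec.map (CommRingCat.ofHom (frobenius (RatFunc M) p)))) := by
  classical
  have hp : p.Prime := Fact.out
  haveI : ExpChar (RatFunc M) p := ExpChar.prime hp
  constructor
  · intro hq
    haveI : Smooth (pullback.snd q (Spec.map (CommRingCat.ofHom (frobenius (RatFunc M) p)))) :=
      MorphismProperty.pullback_snd (P := @Smooth) q _ hq
    exact Scheme.IsRegular.of_smooth (pullback.snd q (Spec.map (CommRingCat.ofHom (frobenius (RatFunc M) p))))
      (Scheme.isRegular_Spec (.of (RatFunc M)))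
  · intro hreg
    -- a root tower of `t` in an algebraic closure
    obtain ⟨θ, hθ0, hθ⟩ := exists_rootTower (M := M) (L := AlgebraicClosure (RatFunc M))
    have hθ1 : θ 1 ^ p = algebraMap (RatFunc M) (AlgebraicClosure (RatFunc M)) RatFunc.X := by
      rw [hθ 0, hθ0]
    have hint : IsIntegral (RatFunc M) (θ 1) := isIntegral_rootTower θ hθ0 hθ 1
    haveI : FiniteDimensional (RatFunc M) (RatFunc M)⟮θ 1⟯ := adjoin.finiteDimensional hint
    haveI : IsPurelyInseparable (RatFunc M) (RatFunc M)⟮θ 1⟯ :=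
      (IntermediateField.isPurelyInseparable_adjoin_simple_iff_pow_mem (F := RatFunc M)
        (E := AlgebraicClosure (RatFunc M)) (q := p)).mpr
        ⟨1, ⟨RatFunc.X, by rw [pow_one, hθ1]⟩⟩
    -- the iterated Frobenius `ψ : K⟮θ 1⟯ → K` over `Frob : K → K`
    have hexp := exponent_adjoin_root_le_one M hθ1
    let ψ : (RatFunc M)⟮θ 1⟯ →+* RatFunc M :=
      IsPurelyInseparable.iterateFrobenius (RatFunc M) (RatFunc M)⟮θ 1⟯ p hexp
    have hψ : ψ.comp (algebraMap (RatFunc M) (RatFunc M)⟮θ 1⟯) = frobenius (RatFunc M) p := by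
      ext c
      rw [RingHom.comp_apply, IsPurelyInseparable.iterateFrobenius_algebraMap, pow_one, frobenius_def]
    -- `Y^{(p)} ≅ (Y ×_K K⟮θ 1⟯) ×_{ψ} K`: regularity descends to the first level, and the criterion applies
    have h1 := isRegular_pullback_of_ringHom (frobenius (RatFunc M) p) ψ hψ q hreg
    exact smooth_of_isRegular_pullback_levelOne θ hθ0 hθ q h1

end Twist

end Summit.ResolutionOfSingularities.ResolutionOfSingularities.Theorems.CampaignW82

end
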